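import Mathlib
import HarnessLib

/-!
# Line-bound blocks: `Σ ½log((x₀+i)² + y²)` against its integral (E5 bricks for the two-tale `Decay` inputs)

HONEST FRAMING: systematic search; no irrationality claim unless certified.

Cell pub-zeta5, T3 service (P1 g9) for fam-denom's E5 (`families/denom/P15KERNEL.md` §6.1/§7): on a vertical line
`t = x + iy` the modulus of Zudilin's rational function is a product of block factors `∏_i √((u+i)² + y²)`, and
`log` of a block is a SUM of the unimodal function `v ↦ ½ log(v² + y²)` over consecutive nodes `v = x₀, x₀+1, …, x₀+L`.
This file (pure real analysis, `y ≠ 0` — a null set of the `dy`-integral is discarded upstream) provides: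

* `halfLog y v = ½ log(v²+y²)`, its primitive `prim y v = v·½log(v²+y²) − v + y·arctan(v/y)` (`hasDerivAt_prim`,
  `integral_halfLog`), monotonicity on `[0,∞)` / antitonicity on `(−∞,0]`;
* `unit_integral_ge`: `∫_t^{t+1} ½log(v²+y²) dv ≥ −(1 + log 2)` for EVERY unit interval
  (via `log|v| ≤ ½log(v²+y²)`, `integral_log` and the binary-entropy bound);
* **`sum_halfLog_le`** (numerator blocks, `L ≥ 1`, the minimum may lie inside the block):
  `Σ_{i=0}^{L} ½log((x₀+i)²+y²) ≤ (prim y (x₀+L) − prim y x₀) + ½log(x₀²+y²) + ½log((x₀+L)²+y²) + (1 + log 2)`;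
* **`le_sum_halfLog`** (denominator block, `x₀ ≥ 1`): `prim y (x₀+L) − prim y (x₀−1) ≤ Σ_{i=0}^{L} ½log((x₀+i)²+y²)`.
No statement about `ζ(2)`; Stirling, the `η`-certificate and the Laplace assembly are NOT here.
-/

noncomputable section

open Real Set MeasureTheory intervalIntegral

namespace Summit.KontsevichZagierPeriods.Zeta5Search.TwoTaleLineBound

/-! ### The integrand and its primitive -/

/-- `½ log(v² + y²) = log |v + iy|`. -/
def halfLog (y v : ℝ) : ℝ := Real.log (v ^ 2 + y ^ 2) / 2

/-- The primitive `v·½log(v²+y²) − v + y·arctan(v/y)` of `halfLog y`. -/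
def prim (y v : ℝ) : ℝ := v * (Real.log (v ^ 2 + y ^ 2) / 2) - v + y * Real.arctan (v / y)

variable {y : ℝ}

/-- `v² + y² > 0` for `y ≠ 0`. -/
theorem sq_add_sq_pos (hy : y ≠ 0) (v : ℝ) : 0 < v ^ 2 + y ^ 2 := by positivity

/-- `halfLog y` is even in `v`. -/
theorem halfLog_neg (y v : ℝ) : halfLog y (-v) = halfLog y v := by unfold halfLog; rw [neg_sq]

/-- `d/dv prim = halfLog` (`y ≠ 0`). -/
theorem hasDerivAt_prim (hy : y ≠ 0) (v : ℝ) : HasDerivAt (prim y) (halfLog y v) v := by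
  have hpos := sq_add_sq_pos hy v
  have h1 : HasDerivAt (fun v : ℝ => v ^ 2 + y ^ 2) (2 * v) v := by
    simpa using (hasDerivAt_pow 2 v).add_const (y ^ 2)
  have h2 : HasDerivAt (fun v : ℝ => Real.log (v ^ 2 + y ^ 2) / 2) (2 * v / (v ^ 2 + y ^ 2) / 2) v :=
    (h1.log hpos.ne').div_const 2
  have h3 : HasDerivAt (fun v : ℝ => v * (Real.log (v ^ 2 + y ^ 2) / 2))
      (1 * (Real.log (v ^ 2 + y ^ 2) / 2) + v * (2 * v / (v ^ 2 + y ^ 2) / 2)) v := (hasDerivAt_id v).mul h2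
  have h4 : HasDerivAt (fun v : ℝ => y * Real.arctan (v / y)) (y * (1 / (1 + (v / y) ^ 2) * (1 / y))) v := by
    have := ((hasDerivAt_id v).div_const y).arctan
    simpa using this.const_mul y
  have h : HasDerivAt (prim y)
      (1 * (Real.log (v ^ 2 + y ^ 2) / 2) + v * (2 * v / (v ^ 2 + y ^ 2) / 2) - 1
        + y * (1 / (1 + (v / y) ^ 2) * (1 / y))) v := (h3.sub (hasDerivAt_id v)).add h4
  refine h.congr_deriv ?_
  unfold halfLog
  field_simp
  ring

/-- `halfLog y` is continuous (`y ≠ 0`). -/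
theorem continuous_halfLog (hy : y ≠ 0) : Continuous (halfLog y) := by
  unfold halfLog
  exact (Continuous.log (by continuity) fun v => (sq_add_sq_pos hy v).ne').div_const 2

/-- **`∫_a^b ½log(v²+y²) dv = prim y b − prim y a`** (`y ≠ 0`). -/
theorem integral_halfLog (hy : y ≠ 0) (a b : ℝ) : ∫ v in a..b, halfLog y v = prim y b - prim y a :=
  integral_eq_sub_of_hasDerivAt (fun v _ => hasDerivAt_prim hy v) ((continuous_halfLog hy).intervalIntegrable _ _)

/-- `halfLog y` is monotone on `[0, ∞)` (`y ≠ 0`). -/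
theorem monotoneOn_halfLog (hy : y ≠ 0) : MonotoneOn (halfLog y) (Ici 0) := by
  intro u hu v hv huv
  unfold halfLog
  rw [mem_Ici] at hu hv
  exact div_le_div_of_nonneg_right (Real.log_le_log (sq_add_sq_pos hy u) (by nlinarith)) (by norm_num)

/-- `halfLog y` is antitone on `(−∞, 0]` (`y ≠ 0`). -/
theorem antitoneOn_halfLog (hy : y ≠ 0) : AntitoneOn (halfLog y) (Iic 0) := by
  intro u hu v hv huv
  rw [mem_Iic] at hu hv
  have h := monotoneOn_halfLog hy (show (0:ℝ) ≤ -v by linarith) (show (0:ℝ) ≤ -u by linarith) (by linarith)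
  rwa [halfLog_neg, halfLog_neg] at h

/-- `log|v| ≤ ½log(v²+y²)` for `v ≠ 0`. -/
theorem log_le_halfLog (y : ℝ) {v : ℝ} (hv : v ≠ 0) : Real.log v ≤ halfLog y v := by
  unfold halfLog
  rw [le_div_iff₀ (by norm_num : (0:ℝ) < 2), ← Real.log_abs,
    show Real.log |v| * 2 = Real.log (|v| ^ 2) by rw [Real.log_pow]; push_cast; ring, sq_abs]
  exact Real.log_le_log (by positivity) (by nlinarith [sq_nonneg y])

/-- **Every unit interval costs at most `1 + log 2`**: `−(1 + log 2) ≤ ∫_t^{t+1} ½log(v²+y²) dv` for all real `t`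
(compare with `∫_t^{t+1} log|v| dv = (t+1)log|t+1| − t log|t| − 1 = −H(t+1) − 1 ≥ −log 2 − 1`, binary entropy `H ≤ log 2`;
the extremal interval is `[−½, ½]`). -/
theorem unit_integral_ge (hy : y ≠ 0) (t : ℝ) : -(1 + Real.log 2) ≤ ∫ v in t..t + 1, halfLog y v := by
  have hle : ∫ v in t..t + 1, Real.log v ≤ ∫ v in t..t + 1, halfLog y v := by
    refine intervalIntegral.integral_mono_ae_restrict (by linarith) intervalIntegral.intervalIntegrable_log'
      ((continuous_halfLog hy).intervalIntegrable _ _) ?_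
    rw [Filter.EventuallyLE, ae_restrict_iff' measurableSet_Icc]
    have h0 : ∀ᵐ v : ℝ ∂volume, v ≠ 0 := by
      have : (volume : Measure ℝ) {0} = 0 := measure_singleton 0
      filter_upwards [measure_eq_zero_iff_ae_notMem.1 this] with v hv
      simpa using hv
    filter_upwards [h0] with v hv _
    exact log_le_halfLog y hv
  refine le_trans ?_ hle
  rw [integral_log]
  have hH := Real.binEntropy_le_log_two (p := t + 1)
  unfold Real.binEntropy at hH
  rw [Real.log_inv, Real.log_inv, show 1 - (t + 1) = -t by ring, Real.log_neg_eq_log] at hH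
  nlinarith [hH]

/-! ### Block sums against the integral -/

/-- **Numerator block** (unimodal, minimum anywhere): for `y ≠ 0`, any real `x₀` and `L : ℕ`,
`Σ_{i=0}^{L} ½log((x₀+i)²+y²) ≤ (prim y (x₀+L) − prim y x₀) + ½log(x₀²+y²) + ½log((x₀+L)²+y²) + (1 + log 2)`. -/
theorem sum_halfLog_le (hy : y ≠ 0) (x₀ : ℝ) {L : ℕ} (hL : 1 ≤ L) :
    ∑ i ∈ Finset.range (L + 1), halfLog y (x₀ + i) ≤
      (prim y (x₀ + L) - prim y x₀) + halfLog y x₀ + halfLog y (x₀ + L) + (1 + Real.log 2) := by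
  have hI : ∀ a b : ℝ, ∫ v in a..b, halfLog y v = prim y b - prim y a := integral_halfLog hy
  -- peel off the two end nodes: Σ_{0..L} = g(x₀) + Σ_{i<L-1} g(x₀+(i+1)) + g(x₀+L)
  have hsplit : ∑ i ∈ Finset.range (L + 1), halfLog y (x₀ + i) =
      halfLog y x₀ + ∑ i ∈ Finset.range (L - 1), halfLog y (x₀ + ((i + 1 : ℕ) : ℝ)) + halfLog y (x₀ + L) := by
    rw [Finset.sum_range_succ, show L = (L - 1) + 1 by omega, Finset.sum_range_succ', Nat.add_sub_cancel]
    push_cast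
    ring_nf
  rw [hsplit]
  suffices hmid : ∑ i ∈ Finset.range (L - 1), halfLog y (x₀ + ((i + 1 : ℕ) : ℝ)) ≤
      (∫ v in x₀..x₀ + L, halfLog y v) + (1 + Real.log 2) by
    rw [hI] at hmid; linarith
  by_cases hx : 0 ≤ x₀
  · -- whole block on the monotone side: drop the first unit interval
    have e : ∀ i : ℕ, x₀ + ((i + 1 : ℕ) : ℝ) = (x₀ + 1) + i := fun i => by push_cast; ring
    simp_rw [e]
    have h1 : ∑ i ∈ Finset.range (L - 1), halfLog y ((x₀ + 1) + i) ≤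
        ∫ v in (x₀ + 1)..(x₀ + 1) + ((L - 1 : ℕ) : ℝ), halfLog y v :=
      MonotoneOn.sum_le_integral ((monotoneOn_halfLog hy).mono fun v hv => by
        simp only [mem_Icc] at hv; rw [mem_Ici]; linarith [hv.1])
    have hunit := unit_integral_ge hy x₀
    have hsum : (∫ v in x₀..x₀ + 1, halfLog y v) + ∫ v in (x₀ + 1)..(x₀ + 1) + ((L - 1 : ℕ) : ℝ), halfLog y v =
        ∫ v in x₀..x₀ + L, halfLog y v := by
      rw [hI, hI, hI, Nat.cast_sub hL]; push_cast; ring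
    linarith [h1, hsum, hunit]
  · push Not at hx
    by_cases hx' : x₀ + L ≤ 0
    · -- whole block on the antitone side: drop the last unit interval
      have h1 : ∑ i ∈ Finset.range (L - 1), halfLog y (x₀ + ((i + 1 : ℕ) : ℝ)) ≤
          ∫ v in x₀..x₀ + ((L - 1 : ℕ) : ℝ), halfLog y v :=
        AntitoneOn.sum_le_integral ((antitoneOn_halfLog hy).mono fun v hv => by
          simp only [mem_Icc] at hv; rw [mem_Iic]; rw [Nat.cast_sub hL] at hv; push_cast at hv; linarith [hv.2])
      have hunit := unit_integral_ge hy (x₀ + ((L - 1 : ℕ) : ℝ))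
      have hsum : (∫ v in x₀..x₀ + ((L - 1 : ℕ) : ℝ), halfLog y v) +
          ∫ v in (x₀ + ((L - 1 : ℕ) : ℝ))..(x₀ + ((L - 1 : ℕ) : ℝ)) + 1, halfLog y v = ∫ v in x₀..x₀ + L, halfLog y v := by
        rw [hI, hI, hI, Nat.cast_sub hL]; push_cast; ring_nf
      linarith [h1, hsum, hunit]
    · -- the minimum 0 lies strictly inside: split at m = ⌊−x₀⌋₊, drop the unit interval through 0
      push Not at hx'
      set m : ℕ := ⌊-x₀⌋₊ with hm
      have hm1 : (m : ℝ) ≤ -x₀ := Nat.floor_le (by linarith)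
      have hm2 : -x₀ < m + 1 := Nat.lt_floor_add_one (-x₀)
      have hmL : m + 1 ≤ L := by
        have : (m : ℝ) < L := by linarith
        exact_mod_cast this
      rw [← Finset.sum_range_add_sum_Ico _ (show m ≤ L - 1 by omega)]
      have hA : ∑ i ∈ Finset.range m, halfLog y (x₀ + ((i + 1 : ℕ) : ℝ)) ≤ ∫ v in x₀..x₀ + m, halfLog y v :=
        AntitoneOn.sum_le_integral ((antitoneOn_halfLog hy).mono fun v hv => by
          simp only [mem_Icc] at hv; rw [mem_Iic]; linarith [hv.2])
      have hB : ∑ i ∈ Finset.Ico m (L - 1), halfLog y (x₀ + ((i + 1 : ℕ) : ℝ)) ≤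
          ∫ v in (x₀ + m + 1)..(x₀ + m + 1) + ((L - 1 - m : ℕ) : ℝ), halfLog y v := by
        rw [Finset.sum_Ico_eq_sum_range]
        have e : ∀ k : ℕ, x₀ + ((m + k + 1 : ℕ) : ℝ) = (x₀ + m + 1) + k := fun k => by push_cast; ring
        simp_rw [e]
        exact MonotoneOn.sum_le_integral ((monotoneOn_halfLog hy).mono fun v hv => by
          simp only [mem_Icc] at hv; rw [mem_Ici]; linarith [hv.1])
      have hunit := unit_integral_ge hy (x₀ + m)
      have hsum : (∫ v in x₀..x₀ + m, halfLog y v) + (∫ v in (x₀ + m)..(x₀ + m) + 1, halfLog y v) +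
          ∫ v in (x₀ + m + 1)..(x₀ + m + 1) + ((L - 1 - m : ℕ) : ℝ), halfLog y v = ∫ v in x₀..x₀ + L, halfLog y v := by
        rw [hI, hI, hI, hI, Nat.cast_sub (by omega : m ≤ L - 1), Nat.cast_sub hL]; push_cast; ring_nf
      linarith [hA, hB, hunit, hsum]

/-- **Denominator block** (monotone, `x₀ ≥ 1`): `prim y (x₀+L) − prim y (x₀−1) ≤ Σ_{i=0}^{L} ½log((x₀+i)²+y²)`. -/
theorem le_sum_halfLog (hy : y ≠ 0) {x₀ : ℝ} (hx : 1 ≤ x₀) (L : ℕ) :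
    prim y (x₀ + L) - prim y (x₀ - 1) ≤ ∑ i ∈ Finset.range (L + 1), halfLog y (x₀ + i) := by
  have h := MonotoneOn.integral_le_sum (f := halfLog y) (x₀ := x₀ - 1) (a := L + 1)
    ((monotoneOn_halfLog hy).mono fun v hv => by simp only [mem_Icc] at hv; rw [mem_Ici]; linarith [hv.1])
  rw [integral_halfLog hy] at h
  have e : ∀ i : ℕ, x₀ - 1 + ((i + 1 : ℕ) : ℝ) = x₀ + i := fun i => by push_cast; ring
  simp_rw [e] at h
  convert h using 2

end Summit.KontsevichZagierPeriods.Zeta5Search.TwoTaleLineBound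

end
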